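import Literature.Analysis.FluidPDE.KochTataruMild
import Literature.Analysis.FluidPDE.BMOInvAnnihilator
import HarnessLib

/-!
# (T4) discharged: `integral_of_isKochTataruSolution_holds`, and `koch_tataru_holds`

Analysis/FluidPDE proof companion of `Literature/Analysis/FluidPDE/KochTataru.lean` (the
decomposition of the named fact `Literature.Analysis.FluidPDE.koch_tataru`, **ns.S15**,
Koch–Tataru, Adv. Math. 157 (2001), Theorem 2). It **discharges the named fact (T4)**
`integral_of_isKochTataruSolution`: for `u₀` weakly divergence free, polynomially tempered and
in `BMO⁻¹(E; E)`, every solution `v` in Koch–Tataru's class from `u₀` with finite path norm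
solves the integral equation (11) a.e. on every positive slice, `v(t) = e^{tΔ}u₀ - B(v, v)(t)`,
and takes its datum, `v(0) = u₀` a.e. — Lemarié-Rieusset 2016, Thm. 6.1 ((6.11) ⇒ (6.12)) with
Lemma 6.4 (B) and Prop. 6.5 (very weak ⇒ Oseen for fields vanishing at infinity).

* The positive-time clause is `IsKochTataruSolution.ae_eq_heatExtension_sub_kochTataruBilinear`
  of `KochTataruIntegralOfClass.lean`.
* `§ InitialSlice`, the `t = 0` clause (`IsKochTataruSolution.initial_ae_eq`): the duality identity
  at time `0` says that `v(0) - u₀` annihilates every solenoidal test field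
  (`isMildNSSolutionFrom_zero_iff`); `v(0)` and `u₀` are weakly divergence free and lie in
  `BMO⁻¹(E; E)`, so `v(0) - u₀ ∈ BMO⁻¹` (`MemBMOInvVec.sub'`) vanishes a.e. by the annihilator
  lemma in `BMO⁻¹` (`IsWeaklyDivFree.ae_eq_zero_of_memBMOInvVec_of_forall_integral_inner_eq_zero`,
  `BMOInvAnnihilator.lean`: Liouville for weakly harmonic weak divergences of `BMO` fields). No
  temperedness of `v(0)` is needed — a general `BMO⁻¹` function need not be integrable against
  Gaussians, so the heat-flow argument of the positive slices is not available at `t = 0`.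
* `integral_of_isKochTataruSolution_holds : integral_of_isKochTataruSolution E` for every
  finite-dimensional real inner product space `E` (the fact is stated for all `E`; the assembly
  `koch_tataru_of` uses `E = ℝ³`).
* `§ KochTataru`: **`koch_tataru_holds : koch_tataru`** — with (T4) the last named fact of the
  decomposition of `KochTataru.lean` is a theorem, and **ns.S15** (Koch–Tataru 2001, Theorem 2:
  small-data global well-posedness in `BMO⁻¹`, `CriticalRegularity.lean`) follows by
  `koch_tataru_of_T4` (`KochTataruMild.lean`: (L1), (L2), (T1)–(T3) discharged there and below it).

## References

* H. Koch, D. Tataru, *Well-posedness for the Navier–Stokes equations*, Adv. Math. 157 (2001)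
  22–35, Theorem 2 and §3 (11). Bib key `KochTataruAdvMath2001`.
* P. G. Lemarié-Rieusset, *The Navier–Stokes problem in the 21st century*, CRC Press 2016,
  Def. 6.4–6.5, Lemma 6.4 (B), Thm. 6.1, Prop. 6.5. Bib key `LemarieRieusset2016`.
-/

noncomputable section

open MeasureTheory Set Function Filter Metric TopologicalSpace InnerProductSpace
open _root_.Topology _root_.Real
open scoped ENNReal NNReal RealInnerProductSpace

namespace Literature.Analysis.FluidPDE

variable {E : Type*} [NormedAddCommGroup E] [InnerProductSpace ℝ E] [FiniteDimensional ℝ E]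
  [MeasurableSpace E] [BorelSpace E]

/-! ## The initial slice -/

section InitialSlice

/-- A field in `BMO⁻¹(E; E)` is locally integrable (its components are weak divergences, hence
locally integrable). [folklore] -/
theorem locallyIntegrable_of_memBMOInvVec {h : E → E} (hBMO : FunctionSpaces.MemBMOInvVec h) :
    LocallyIntegrable h volume :=
  locallyIntegrable_of_inner fun w => by
    obtain ⟨Φ, -, hrep⟩ := hBMO w
    exact hrep.locallyIntegrable

/-- **A Koch–Tataru class solution takes its datum: `v(0) = u₀` a.e.** (Koch–Tataru 2001,
Theorem 2: the solution is a weakly continuous curve in `BMO⁻¹` starting at `u₀`; here in the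
tree's duality form): the identity `IsMildNSSolutionFrom 1 0 u₀ v 0` says
`∫ ⟪v(0) - u₀, φ⟫ = 0` for all solenoidal tests `φ` (`isMildNSSolutionFrom_zero_iff`); `v(0) - u₀`
is weakly divergence free and in `BMO⁻¹(E; E)`, hence `0` a.e. by the annihilator lemma in `BMO⁻¹`
(Lemarié-Rieusset 2016, Def. 6.4: a solenoidal irrotational field vanishing at infinity is zero).
[cite: LemarieRieusset2016, Def. 6.4 and the uniqueness remark p. 130] -/
theorem IsKochTataruSolution.initial_ae_eq {u₀ : E → E} {v : ℝ → E → E}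
    (hdiv : IsWeaklyDivFree u₀) (hmem : FunctionSpaces.MemBMOInvVec u₀)
    (hv : IsKochTataruSolution u₀ v) : v 0 =ᵐ[volume] u₀ := by
  haveI : CompleteSpace E := FiniteDimensional.complete ℝ E
  set h : E → E := fun x => v 0 x - u₀ x with hh
  have hv0 : FunctionSpaces.MemBMOInvVec (v 0) := hv.memBMOInvVec 0 le_rfl
  have hBMO : FunctionSpaces.MemBMOInvVec h := hv0.sub' hmem
  have hl_v : LocallyIntegrable (v 0) volume := locallyIntegrable_of_memBMOInvVec hv0
  have hl_u : LocallyIntegrable u₀ volume := locallyIntegrable_of_memBMOInvVec hmem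
  -- pairings split
  have hsplit : ∀ {w : E → E}, Continuous w → HasCompactSupport w →
      ∫ x, ⟪h x, w x⟫ = (∫ x, ⟪v 0 x, w x⟫) - ∫ x, ⟪u₀ x, w x⟫ := by
    intro w hw hwc
    have i1 := integrable_inner_of_locallyIntegrable_of_hasCompactSupport hl_v hw hwc
    have i2 := integrable_inner_of_locallyIntegrable_of_hasCompactSupport hl_u hw hwc
    rw [← integral_sub i1 i2]
    refine integral_congr_ae (Eventually.of_forall fun x => ?_)
    simp only [hh, inner_sub_left]
  -- `h` is weakly divergence free
  have hdiv_h : IsWeaklyDivFree h := by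
    intro θ hθ
    have hθ1 : ContDiff ℝ 1 θ := hθ.contDiff.of_le (by exact_mod_cast le_top)
    have hgc : Continuous (gradient θ) := continuous_gradient_of_contDiff hθ1
    have hgs : HasCompactSupport (gradient θ) :=
      (hθ.hasCompactSupport.fderiv (𝕜 := ℝ)).comp_left (g := (InnerProductSpace.toDual ℝ E).symm) (map_zero _)
    rw [hsplit hgc hgs, hv.isWeaklyDivFree le_rfl θ hθ, hdiv θ hθ, sub_zero]
  -- `h` annihilates solenoidal tests: the duality identity at time `0`
  have horth : ∀ φ : E → E, FunctionSpaces.IsTestFunctionOn (⊤ : Opens E) φ → VectorCalculus.IsDivFree φ →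
      ∫ x, ⟪h x, φ x⟫ = 0 := by
    intro φ hφ hφd
    have h0 := isMildNSSolutionFrom_zero_iff.1 (hv.isGlobalMildSolution.2 0 Set.self_mem_Ici) φ hφ hφd
    rw [hsplit hφ.contDiff.continuous hφ.hasCompactSupport, h0, sub_self]
  have hzero := hdiv_h.ae_eq_zero_of_memBMOInvVec_of_forall_integral_inner_eq_zero hBMO horth
  filter_upwards [hzero] with x hx
  exact sub_eq_zero.1 hx

end InitialSlice

/-! ## (T4) -/

section T4

variable (E) in
/-- **(T4) `integral_of_isKochTataruSolution` holds** (Koch–Tataru 2001, Theorem 2 with §3 (11):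
class solutions of finite `X`-norm solve the integral equation; Lemarié-Rieusset 2016, Thm. 6.1,
(6.11) ⇒ (6.12), Lemma 6.4 (B), Prop. 6.5): for every weakly divergence-free, polynomially
tempered `u₀ ∈ BMO⁻¹(E; E)` and every solution `v` in Koch–Tataru's class from `u₀` with
`‖v‖_X < ∞`: `v(t) = e^{tΔ}u₀ - B(v, v)(t)` a.e. for every `t > 0`
(`IsKochTataruSolution.ae_eq_heatExtension_sub_kochTataruBilinear`), and `v(0) = u₀` a.e.
(`IsKochTataruSolution.initial_ae_eq`). [cite: LemarieRieusset2016, Thm. 6.1 (6.11) ⇒ (6.12) with Lemma 6.4 (B) and Prop. 6.5] -/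
theorem integral_of_isKochTataruSolution_holds : integral_of_isKochTataruSolution E := by
  intro u₀ v hdiv hmem htemp hv hvX
  exact ⟨fun t ht => hv.ae_eq_heatExtension_sub_kochTataruBilinear hdiv hmem htemp hvX ht,
    hv.initial_ae_eq hdiv hmem⟩

end T4

/-! ## ns.S15 -/

section KochTataru

/-- **ns.S15, `koch_tataru` holds** (Koch–Tataru, Adv. Math. 157 (2001), Theorem 2: there are
absolute `δ, ε > 0` such that every weakly divergence-free, polynomially tempered
`u₀ : ℝ³ → ℝ³` with `‖u₀‖_{BMO⁻¹} ≤ δ` has a global solution in Koch–Tataru's class with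
`‖u‖_X ≤ ε`, unique among class solutions with `‖v‖_X ≤ ε`): the assembly `koch_tataru_of_T4`
((L1), (L2), (T1)–(T3) discharged in `KochTataruBilinearEstimate.lean`, `KochTataruLinear.lean`,
`KochTataruFixedPoint.lean`, `KochTataruMild.lean`) fed with (T4)
`integral_of_isKochTataruSolution_holds`. [cite: KochTataruAdvMath2001, Theorem 2] -/
theorem koch_tataru_holds : koch_tataru :=
  koch_tataru_of_T4 (integral_of_isKochTataruSolution_holds _)

end KochTataru

end Literature.Analysis.FluidPDE
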